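import Summits.CriticalPhenomena.SAWScalingLimit.Theorems.SAWLoopFugacityFlowIsingBoundaryRatioWindowRectShadow
import Mathlib.Analysis.Complex.CauchyIntegral
import Mathlib.Analysis.Calculus.FDeriv.Analytic
import Mathlib.Analysis.Calculus.MeanValue
import HarnessLib

/-!
# One lattice step in the bulk: the chart moves by `O(δ)` and its radius can be pushed up or down by `≍ δ`
(line `fk-anchor-transfer`, crux `IsingBoundaryRatio`, stmt-CriticalPhenomena-10650; helper file of the stub
`windowRectPresentation_holds : WindowRectPresentation`)

**Theorem** (`exists_bulk_step`). Let `φ : ℍ → D` be a conformal chart of a Jordan domain and `K ⊂ ℍ` compact.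
There are `0 < c ≤ C` such that for all small mesh `δ` and every lattice site `x` whose mesh point lies in `D`
with chart point in `K`: the four lattice neighbours of `x` have mesh points in `D` with chart points within
`C δ` of that of `x`, some neighbour has chart radius larger by `≥ c δ`, and some neighbour has chart radius
smaller by `≥ c δ`.

Proof: `g = φ⁻¹` is holomorphic on `D` with `g' ≠ 0` (`φ ∘ g = id`); on the compact `φ(K)` and a compact
thickening of it in `D`, `|g'|` is bounded below by `c₀ > 0` and above by `C₀`, and `g'` is uniformly continuous,
so `g(z + δ e) = g(z) + δ g'(z) e + o(δ)` uniformly (mean value inequality for `g - g'(z)·id`); among the four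
directions `e ∈ {1, i, -1, -i}` one has radial component of `g'(z) e` at least `|g'(z)|/2` and one at most
`-|g'(z)|/2`. [folklore]
-/

noncomputable section

open scoped Classical Topology ComplexConjugate
open Filter Set Metric Complex
open Literature.Probability.LatticeModels Literature.Probability.RandomPlanarGeometry
open Literature.Probability.LatticeModels.DiscreteRect
open UpperHalfPlane (upperHalfPlaneSet)

namespace Summit.CriticalPhenomena.SAWScalingLimit.Theorems.IsingBoundaryRatio

namespace WindowRect

/-! ### The four lattice directions as complex numbers -/

/-- The direction `e_k` as a complex number: `1, i, -1, -i`. [folklore] -/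
def dirC (k : Fin 4) : ℂ := ![1, I, -1, -I] k

/-- The mesh point of a lattice neighbour: `meshPoint δ (x + e_k) = meshPoint δ x + δ e_k`. [folklore] -/
theorem meshPoint_add_dir_eq (δ : ℝ) (x : Site 2) (k : Fin 4) :
    meshPoint δ (x + dir k) = meshPoint δ x + (δ : ℂ) * dirC k := by
  apply Complex.ext <;> fin_cases k <;> simp [dirC, dir, meshPoint_re, meshPoint_im] <;> ring

/-- `‖e_k‖ = 1`. [folklore] -/
theorem norm_dirC (k : Fin 4) : ‖dirC k‖ = 1 := by
  fin_cases k <;> simp [dirC]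

/-- **Among the four directions, one has real part of `W e_k` at least `‖W‖/2`.** [folklore] -/
theorem exists_re_mul_dirC_ge (W : ℂ) : ∃ k : Fin 4, ‖W‖ / 2 ≤ (W * dirC k).re := by
  have h := Complex.norm_le_abs_re_add_abs_im W
  by_cases hc : |W.im| ≤ |W.re|
  · by_cases hs : 0 ≤ W.re
    · refine ⟨0, ?_⟩; simp [dirC]; rw [abs_of_nonneg hs] at h hc; linarith
    · refine ⟨2, ?_⟩; simp [dirC]; rw [abs_of_neg (not_le.1 hs)] at h hc; linarith
  · push Not at hc
    by_cases hs : 0 ≤ W.im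
    · refine ⟨3, ?_⟩; simp [dirC]; rw [abs_of_nonneg hs] at h hc; linarith
    · refine ⟨1, ?_⟩; simp [dirC]; rw [abs_of_neg (not_le.1 hs)] at h hc; linarith

/-- Among the four directions, one has real part of `W e_k` at most `-‖W‖/2`. [folklore] -/
theorem exists_re_mul_dirC_le (W : ℂ) : ∃ k : Fin 4, (W * dirC k).re ≤ -(‖W‖ / 2) := by
  obtain ⟨k, hk⟩ := exists_re_mul_dirC_ge (-W)
  refine ⟨k, ?_⟩
  rw [norm_neg, neg_mul, Complex.neg_re] at hk
  linarith

/-! ### Radial parts -/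

/-- The radial part of `v` in the direction of `u ≠ 0` is at most `‖v‖`: `(conj u * v).re ≤ ‖u‖ ‖v‖`. [folklore] -/
theorem re_conj_mul_le (u v : ℂ) : (conj u * v).re ≤ ‖u‖ * ‖v‖ := by
  refine (Complex.re_le_norm _).trans ?_
  rw [norm_mul, Complex.norm_conj]

/-- **Lower bound of a norm by a radial part**: `‖w‖ ≥ (conj u * w).re / ‖u‖`. [folklore] -/
theorem div_le_norm (u w : ℂ) (hu : u ≠ 0) : (conj u * w).re / ‖u‖ ≤ ‖w‖ := by
  rw [div_le_iff₀ (norm_pos_iff.2 hu)]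
  have := re_conj_mul_le u w
  linarith [mul_comm ‖u‖ ‖w‖]

/-! ### The theorem -/

set_option maxHeartbeats 400000 in
/-- **One lattice step in the bulk.** See the module docstring. [folklore] -/
theorem exists_bulk_step (D : JordanDomain) (φ : ConformalEquiv upperHalfPlaneSet D.carrier) {K : Set ℂ}
    (hK : IsCompact K) (hKH : K ⊆ upperHalfPlaneSet) :
    ∃ c C : ℝ, 0 < c ∧ c ≤ C ∧ ∀ᶠ δ in 𝓝[>] (0 : ℝ), ∀ x : Site 2, meshPoint δ x ∈ D.carrier →
      φ.symm (meshPoint δ x) ∈ K →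
      (∀ k : Fin 4, meshPoint δ (x + dir k) ∈ D.carrier ∧
        dist (φ.symm (meshPoint δ (x + dir k))) (φ.symm (meshPoint δ x)) ≤ C * δ) ∧
      (∃ k : Fin 4, ‖φ.symm (meshPoint δ x)‖ + c * δ ≤ ‖φ.symm (meshPoint δ (x + dir k))‖) ∧
      (∃ k : Fin 4, ‖φ.symm (meshPoint δ (x + dir k))‖ ≤ ‖φ.symm (meshPoint δ x)‖ - c * δ) := by
  rcases K.eq_empty_or_nonempty with rfl | hKne
  · exact ⟨1, 1, one_pos, le_rfl, Eventually.of_forall fun δ x _ hx => absurd hx (notMem_empty _)⟩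
  -- the inverse chart and its derivative
  set g : ℂ → ℂ := fun z => φ.symm z with hg
  have hgd : DifferentiableOn ℂ g D.carrier := φ.symm.differentiableOn_coe
  have hga : AnalyticOnNhd ℂ g D.carrier := hgd.analyticOnNhd D.isOpen
  have hg'c : ContinuousOn (deriv g) D.carrier := hga.deriv.continuousOn
  have hderiv : ∀ z ∈ D.carrier, HasDerivAt g (deriv g z) z := fun z hz =>
    (hgd.differentiableAt (D.isOpen.mem_nhds hz)).hasDerivAt
  have hg'ne : ∀ z ∈ D.carrier, deriv g z ≠ 0 := by
    intro z hz h0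
    have hgz : g z ∈ upperHalfPlaneSet := φ.symm_mapsTo hz
    have h2 : HasDerivAt φ (deriv φ (g z)) (g z) :=
      (φ.differentiableOn_coe.differentiableAt (UpperHalfPlane.isOpen_upperHalfPlaneSet.mem_nhds hgz)).hasDerivAt
    have h3 : HasDerivAt (φ ∘ g) (deriv φ (g z) * deriv g z) z := h2.comp z (hderiv z hz)
    have h4 : (φ ∘ g) =ᶠ[𝓝 z] id :=
      Filter.eventually_of_mem (D.isOpen.mem_nhds hz) fun w hw => φ.apply_symm_apply hw
    have h5 := (h3.congr_of_eventuallyEq h4.symm).unique (hasDerivAt_id z)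
    rw [h0, mul_zero] at h5
    exact zero_ne_one h5
  -- compact sets
  set KD : Set ℂ := φ '' K with hKD
  have hKDc : IsCompact KD := hK.image_of_continuousOn (φ.continuousOn.mono hKH)
  have hKDne : KD.Nonempty := hKne.image _
  have hKDsub : KD ⊆ D.carrier := by rintro _ ⟨w, hw, rfl⟩; exact φ.mapsTo (hKH hw)
  obtain ⟨ϱ, hϱ, hϱD⟩ := hKDc.exists_cthickening_subset_open D.isOpen hKDsub
  set Cs : Set ℂ := cthickening ϱ KD with hCs
  have hCsc : IsCompact Cs := hKDc.cthickening
  have hKDCs : KD ⊆ Cs := self_subset_cthickening _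
  -- bounds on `‖g'‖` and `‖w‖`
  obtain ⟨zm, hzm, hmin⟩ := hKDc.exists_isMinOn hKDne ((continuous_norm.comp_continuousOn hg'c).mono hKDsub)
  obtain ⟨zM, hzM, hmax⟩ := hCsc.exists_isMaxOn (hKDne.mono hKDCs) ((continuous_norm.comp_continuousOn hg'c).mono hϱD)
  obtain ⟨wm, hwm, hwmin⟩ := hK.exists_isMinOn hKne continuous_norm.continuousOn
  set c₀ : ℝ := ‖deriv g zm‖ with hc₀
  set C₀ : ℝ := ‖deriv g zM‖ with hC₀
  set hK0 : ℝ := ‖wm‖ with hhK0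
  have hc₀pos : 0 < c₀ := norm_pos_iff.2 (hg'ne zm (hKDsub hzm))
  have hc₀C₀ : c₀ ≤ C₀ := hmax (hKDCs hzm)
  have hhK0pos : 0 < hK0 := by
    have : 0 < wm.im := hKH hwm
    exact norm_pos_iff.2 fun h => by rw [h] at this; simp at this
  have hlow : ∀ z ∈ KD, c₀ ≤ ‖deriv g z‖ := fun z hz => hmin hz
  have hup : ∀ z ∈ Cs, ‖deriv g z‖ ≤ C₀ := fun z hz => hmax hz
  have hnormK : ∀ w ∈ K, hK0 ≤ ‖w‖ := fun w hw => hwmin hw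
  -- uniform continuity of `g'` on `Cs`
  obtain ⟨τ, hτ, hτU⟩ := Metric.uniformContinuousOn_iff.1 (hCsc.uniformContinuousOn_of_continuous (hg'c.mono hϱD))
    (c₀ / 10) (by positivity)
  -- the constants and the threshold
  refine ⟨c₀ / 8, C₀ + c₀, by positivity, by linarith, ?_⟩
  have hδ₀ : 0 < min (min (ϱ / 2) (τ / 2)) (min (hK0 * c₀ / (4 * (C₀ + 1) ^ 2)) (hK0 / (4 * c₀))) := by positivity
  filter_upwards [Ioo_mem_nhdsGT hδ₀] with δ hδ
  obtain ⟨hδ0, hδlt⟩ := hδ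
  have hδϱ : δ < ϱ := by linarith [(lt_min_iff.1 (lt_min_iff.1 hδlt).1).1]
  have hδτ : δ < τ := by linarith [(lt_min_iff.1 (lt_min_iff.1 hδlt).1).2]
  have hδq : δ ≤ hK0 * c₀ / (4 * (C₀ + 1) ^ 2) := (lt_min_iff.1 (lt_min_iff.1 hδlt).2).1.le
  have hδq' : δ ≤ hK0 / (4 * c₀) := (lt_min_iff.1 (lt_min_iff.1 hδlt).2).2.le
  -- consequences of the threshold
  have hq1 : (C₀ + 1) ^ 2 * δ ≤ hK0 * c₀ / 4 := by
    have := (le_div_iff₀ (by positivity : (0 : ℝ) < 4 * (C₀ + 1) ^ 2)).1 hδq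
    linarith
  have hq2 : C₀ ^ 2 * δ ≤ hK0 * c₀ / 4 := by
    have h1 : C₀ ^ 2 ≤ (C₀ + 1) ^ 2 := by nlinarith [hc₀pos.le.trans hc₀C₀]
    nlinarith
  have hq3 : c₀ * δ ≤ hK0 / 4 := by
    have := (le_div_iff₀ (by positivity : (0 : ℝ) < 4 * c₀)).1 hδq'
    linarith
  intro x hxD hxK
  have re_conj_mul_self : ∀ u : ℂ, (conj u * u).re = ‖u‖ ^ 2 := fun u => by
    rw [← Complex.normSq_eq_norm_sq, Complex.normSq_apply]; simp [Complex.mul_re]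
  have re_mul_conj_eq : ∀ u v : ℂ, (u * conj v).re = (conj u * v).re := fun u v => by simp [Complex.mul_re]
  set z : ℂ := meshPoint δ x with hz
  have hzKD : z ∈ KD := ⟨g z, hxK, φ.apply_symm_apply hxD⟩
  have hball : closedBall z δ ⊆ Cs := (closedBall_subset_cthickening hzKD δ).trans (cthickening_mono hδϱ.le _)
  have hballD : closedBall z δ ⊆ D.carrier := hball.trans hϱD
  set a : ℂ := deriv g z with ha
  have haC : ‖a‖ ≤ C₀ := hup z (hKDCs hzKD)
  have hac : c₀ ≤ ‖a‖ := hlow z hzKD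
  -- neighbours
  have hzk : ∀ k : Fin 4, meshPoint δ (x + dir k) = z + (δ : ℂ) * dirC k := fun k => meshPoint_add_dir_eq δ x k
  have hdist : ∀ k : Fin 4, dist (z + (δ : ℂ) * dirC k) z = δ := by
    intro k; rw [dist_eq_norm, add_sub_cancel_left, norm_mul, norm_real, Real.norm_eq_abs, abs_of_pos hδ0, norm_dirC, mul_one]
  have hmemball : ∀ k : Fin 4, z + (δ : ℂ) * dirC k ∈ closedBall z δ := fun k => mem_closedBall.2 (hdist k).le
  -- linearisation
  have lin : ∀ k : Fin 4, ‖g (z + δ * dirC k) - g z - a * (δ * dirC k)‖ ≤ c₀ / 10 * δ := by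
    intro k
    have hconv : Convex ℝ (closedBall z δ) := convex_closedBall z δ
    have hf : ∀ w ∈ closedBall z δ, DifferentiableAt ℂ (fun w => g w - a * w) w := fun w hw =>
      (hgd.differentiableAt (D.isOpen.mem_nhds (hballD hw))).sub ((differentiableAt_id).const_mul a)
    have hbound : ∀ w ∈ closedBall z δ, ‖deriv (fun w => g w - a * w) w‖ ≤ c₀ / 10 := by
      intro w hw
      have hdw : DifferentiableAt ℂ g w := hgd.differentiableAt (D.isOpen.mem_nhds (hballD hw))
      have hdl : DifferentiableAt ℂ (fun w : ℂ => a * w) w := (differentiableAt_id).const_mul a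
      have e' : deriv (fun w : ℂ => a * w) w = a := by simp
      have e : deriv (fun w => g w - a * w) w = deriv g w - a := by
        rw [deriv_fun_sub hdw hdl, e']
      rw [e, ← dist_eq_norm]
      exact (hτU w (hball hw) z (hKDCs hzKD) ((mem_closedBall.1 hw).trans_lt hδτ)).le
    have h := hconv.norm_image_sub_le_of_norm_deriv_le hf hbound (mem_closedBall_self hδ0.le) (hmemball k)
    rw [show ‖z + ↑δ * dirC k - z‖ = δ by rw [← dist_eq_norm]; exact hdist k] at h
    have e4 : g (z + ↑δ * dirC k) - g z - a * (↑δ * dirC k) =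
        (g (z + ↑δ * dirC k) - a * (z + ↑δ * dirC k)) - (g z - a * z) := by ring
    rw [e4]; exact h
  refine ⟨fun k => ⟨?_, ?_⟩, ?_, ?_⟩
  · rw [hzk]; exact hballD (hmemball k)
  · rw [hzk, dist_eq_norm]
    have h1 := lin k
    have h2 : ‖a * (δ * dirC k)‖ ≤ C₀ * δ := by
      rw [norm_mul, norm_mul, norm_real, Real.norm_eq_abs, abs_of_pos hδ0, norm_dirC, mul_one]
      exact mul_le_mul_of_nonneg_right haC hδ0.le
    calc ‖g (z + ↑δ * dirC k) - g z‖ = ‖(g (z + δ * dirC k) - g z - a * (δ * dirC k)) + a * (δ * dirC k)‖ := by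
          congr 1; ring
      _ ≤ ‖g (z + δ * dirC k) - g z - a * (δ * dirC k)‖ + ‖a * (δ * dirC k)‖ := norm_add_le _ _
      _ ≤ (C₀ + c₀) * δ := by nlinarith
  · -- increase
    have huK : g z ∈ K := hxK
    have hA : hK0 ≤ ‖g z‖ := hnormK _ huK
    have hu0 : g z ≠ 0 := norm_pos_iff.1 (hhK0pos.trans_le hA)
    have hWn : ‖conj (g z) * a‖ = ‖g z‖ * ‖a‖ := by rw [norm_mul, Complex.norm_conj]
    obtain ⟨k, hk⟩ := exists_re_mul_dirC_ge (conj (g z) * a)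
    refine ⟨k, ?_⟩
    rw [hzk]
    -- `‖g z_k‖ ≥ (conj (g z) * g z_k).re / ‖g z‖`
    refine le_trans ?_ (div_le_norm (g z) _ hu0)
    rw [le_div_iff₀ (norm_pos_iff.2 hu0)]
    have e1 : conj (g z) * g (z + ↑δ * dirC k) = conj (g z) * g z + (δ : ℂ) * (conj (g z) * a * dirC k) +
        conj (g z) * (g (z + δ * dirC k) - g z - a * (δ * dirC k)) := by ring
    rw [e1, Complex.add_re, Complex.add_re, re_conj_mul_self, Complex.re_ofReal_mul]
    have hn : ‖conj (g z) * (g (z + δ * dirC k) - g z - a * (δ * dirC k))‖ ≤ ‖g z‖ * (c₀ / 10 * δ) := by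
      rw [norm_mul, Complex.norm_conj]; exact mul_le_mul_of_nonneg_left (lin k) (norm_nonneg _)
    have h3 := (abs_le.1 ((Complex.abs_re_le_norm (conj (g z) * (g (z + δ * dirC k) - g z - a * (δ * dirC k)))).trans hn)).1
    have h4 : ‖g z‖ * ‖a‖ / 2 ≤ (conj (g z) * a * dirC k).re := by rw [← hWn]; exact hk
    have h5 : 0 ≤ ‖g z‖ := norm_nonneg _
    have h6 : δ * (‖g z‖ * ‖a‖ / 2) ≤ δ * (conj (g z) * a * dirC k).re := mul_le_mul_of_nonneg_left h4 hδ0.le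
    have h7 : δ * (‖g z‖ * c₀) ≤ δ * (‖g z‖ * ‖a‖) := mul_le_mul_of_nonneg_left (mul_le_mul_of_nonneg_left hac h5) hδ0.le
    have h8 : 0 ≤ δ * (‖g z‖ * c₀) := by positivity
    linarith [h3, h6, h7, h8]
  · -- decrease
    have huK : g z ∈ K := hxK
    have hA : hK0 ≤ ‖g z‖ := hnormK _ huK
    have hWn : ‖conj (g z) * a‖ = ‖g z‖ * ‖a‖ := by rw [norm_mul, Complex.norm_conj]
    obtain ⟨k, hk⟩ := exists_re_mul_dirC_le (conj (g z) * a)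
    refine ⟨k, ?_⟩
    rw [hzk]
    have e1 : g (z + ↑δ * dirC k) = (g z + a * (δ * dirC k)) + (g (z + δ * dirC k) - g z - a * (δ * dirC k)) := by ring
    have hvn : ‖a * (δ * dirC k)‖ ≤ C₀ * δ := by
      rw [norm_mul, norm_mul, norm_real, Real.norm_eq_abs, abs_of_pos hδ0, norm_dirC, mul_one]
      exact mul_le_mul_of_nonneg_right haC hδ0.le
    have hrad : (conj (g z) * (a * (δ * dirC k))).re ≤ -(‖g z‖ * ‖a‖ * δ / 2) := by
      have : conj (g z) * (a * (δ * dirC k)) = (δ : ℂ) * (conj (g z) * a * dirC k) := by ring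
      rw [this, Complex.re_ofReal_mul, ← hWn]
      nlinarith
    -- `‖g z + v‖ ≤ ‖g z‖ - c₀ δ / 4`
    have h5 : 0 ≤ ‖g z‖ := norm_nonneg _
    have k1 : ‖g z + a * (δ * dirC k)‖ ^ 2 ≤ ‖g z‖ ^ 2 + (C₀ * δ) ^ 2 - ‖g z‖ * c₀ * δ := by
      have e2 : ‖g z + a * (δ * dirC k)‖ ^ 2 = ‖g z‖ ^ 2 + ‖a * (δ * dirC k)‖ ^ 2 + 2 * (conj (g z) * (a * (δ * dirC k))).re := by
        rw [← Complex.normSq_eq_norm_sq, Complex.normSq_add, Complex.normSq_eq_norm_sq, Complex.normSq_eq_norm_sq,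
          re_mul_conj_eq]
      have hv2 : ‖a * (δ * dirC k)‖ ^ 2 ≤ (C₀ * δ) ^ 2 := pow_le_pow_left₀ (norm_nonneg _) hvn 2
      have h7 : ‖g z‖ * c₀ * δ ≤ ‖g z‖ * ‖a‖ * δ :=
        mul_le_mul_of_nonneg_right (mul_le_mul_of_nonneg_left hac h5) hδ0.le
      rw [e2]; linarith
    have k2 : (C₀ * δ) ^ 2 ≤ ‖g z‖ * c₀ * δ / 2 := by
      have h8 : (C₀ * δ) ^ 2 = δ * (C₀ ^ 2 * δ) := by ring
      have h9 : δ * (C₀ ^ 2 * δ) ≤ δ * (hK0 * c₀ / 4) := mul_le_mul_of_nonneg_left hq2 hδ0.le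
      have h10 : δ * (hK0 * c₀) ≤ δ * (‖g z‖ * c₀) :=
        mul_le_mul_of_nonneg_left (mul_le_mul_of_nonneg_right hA hc₀pos.le) hδ0.le
      have h11 : 0 ≤ δ * (‖g z‖ * c₀) := by positivity
      rw [h8]; linarith
    have hsq : ‖g z + a * (δ * dirC k)‖ ^ 2 ≤ (‖g z‖ - c₀ * δ / 4) ^ 2 := by
      have e3 : (‖g z‖ - c₀ * δ / 4) ^ 2 = ‖g z‖ ^ 2 - ‖g z‖ * c₀ * δ / 2 + (c₀ * δ) ^ 2 / 16 := by ring
      rw [e3]; nlinarith [sq_nonneg (c₀ * δ)]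
    have hpos : 0 ≤ ‖g z‖ - c₀ * δ / 4 := by linarith
    have huv : ‖g z + a * (δ * dirC k)‖ ≤ ‖g z‖ - c₀ * δ / 4 := by
      by_contra hcon
      push Not at hcon
      have := mul_lt_mul'' hcon hcon hpos hpos
      nlinarith [norm_nonneg (g z + a * (δ * dirC k))]
    show ‖g (z + ↑δ * dirC k)‖ ≤ ‖g z‖ - c₀ / 8 * δ
    rw [e1]
    calc ‖g z + a * (↑δ * dirC k) + (g (z + ↑δ * dirC k) - g z - a * (↑δ * dirC k))‖
        ≤ ‖g z + a * (↑δ * dirC k)‖ + ‖g (z + ↑δ * dirC k) - g z - a * (↑δ * dirC k)‖ := norm_add_le _ _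
      _ ≤ (‖g z‖ - c₀ * δ / 4) + c₀ / 10 * δ := add_le_add huv (lin k)
      _ ≤ ‖g z‖ - c₀ / 8 * δ := by
          have : 0 ≤ c₀ * δ := by positivity
          linarith

end WindowRect

/-- **One lattice step in the bulk**, closed form (registered sub-goal of stmt-CriticalPhenomena-10650). [folklore] -/
theorem windowRect_exists_bulk_step : ∀ (D : Literature.Probability.RandomPlanarGeometry.JordanDomain) (φ : Literature.Probability.RandomPlanarGeometry.ConformalEquiv UpperHalfPlane.upperHalfPlaneSet D.carrier) {K : Set ℂ}, IsCompact K → K ⊆ UpperHalfPlane.upperHalfPlaneSet → ∃ c C : ℝ, 0 < c ∧ c ≤ C ∧ ∀ᶠ δ in nhdsWithin (0 : ℝ) (Set.Ioi 0), ∀ x : Site 2, meshPoint δ x ∈ D.carrier → φ.symm (meshPoint δ x) ∈ K → (∀ k : Fin 4, meshPoint δ (x + DiscreteRect.dir k) ∈ D.carrier ∧ dist (φ.symm (meshPoint δ (x + DiscreteRect.dir k))) (φ.symm (meshPoint δ x)) ≤ C * δ) ∧ (∃ k : Fin 4, ‖φ.symm (meshPoint δ x)‖ + c * δ ≤ ‖φ.symm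 (meshPoint δ (x + DiscreteRect.dir k))‖) ∧ (∃ k : Fin 4, ‖φ.symm (meshPoint δ (x + DiscreteRect.dir k))‖ ≤ ‖φ.symm (meshPoint δ x)‖ - c * δ) :=
  fun D φ _ hK hKH => WindowRect.exists_bulk_step D φ hK hKH

end Summit.CriticalPhenomena.SAWScalingLimit.Theorems.IsingBoundaryRatio

end
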